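import Mathlib
import Summits.AnomalousDissipation.AnomalousDissipation.Theorems.LimitingAbsorptionScalarSectorLiftModes
import Literature.Analysis.FunctionSpaces.TorusRieszFischerParam
import Literature.Analysis.FunctionSpaces.TorusVectorParseval
import Literature.Analysis.FunctionSpaces.TorusSobolevNormProofs
import HarnessLib

/-!
# Route LimitingAbsorption — support item `ScalarSectorLift` (stmt-AnomalousDissipation-2941), part B:
# the everywhere-defined `L²` representative and its weak continuity

Second file of the proof of
`Summit.AnomalousDissipation.AnomalousDissipation.Theses.LimitingAbsorption.ScalarSectorLift`.
With the continuous modes `c(t, k)` of part A (`…ScalarSectorLiftModes`) of a global weak sourced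
scalar `θ` we build the **representative** `Θ` of `θ`: at `t = 0` the datum `θ₀`, at the good
times the slice `θ(t)` itself, and at the (null set of) remaining times the `L²` function with
Fourier coefficients `c(t, ·)` (Riesz–Fischer, from the tree's parametric version
`Torus.exists_memLp_two_forall_mFourierCoeff_eq` at a Dirac parameter; reality from the conjugate
symmetry of the modes). Results:

* `ssl_tendsto_tsum_conj_mul` — abstract weak convergence in `ℓ²(ℤ^d)`: coefficientwise
  convergence under a uniform `ℓ²` bound gives convergence of the pairings `∑ₖ conj(aₖ) wₖ`
  against every `w ∈ ℓ²` (Young's inequality with a free parameter on the tails;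
  Robinson–Rodrigo–Sadowski 2016, (4.12) / Ex. 4.3);
* `ssl_exists_memLp_real_of_coeff` — Riesz–Fischer for a conjugate-symmetric `ℓ²` family: a real
  `L²` function with the prescribed coefficients;
* `ssl_exists_repr` — **the representative**: `Θ 0 = θ₀`; for every `t ≥ 0`, `Θ(t) ∈ L²` with
  `𝓕Θ(t) = c(t, ·)`; and `Θ(t) = θ(t)` for a.e. `t ∈ (0, T)`, every `T`;
* `ssl_integral_sq_repr_le` — `∫ Θ(t)² = ∑ₖ ‖c(t,k)‖² ≤ C_T` for every `t ∈ [0, T]`;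
* `ssl_continuousOn_integral_repr_mul` — **weak continuity** of `t ↦ Θ(t)` into `L²` on
  `[0, ∞)` (Parseval pairing + `ssl_tendsto_tsum_conj_mul`);

References: Grafakos 2014, Prop. 3.2.7 (3)–(4); Robinson–Rodrigo–Sadowski 2016, Thm. 4.4 Step 3,
(4.12), Ex. 4.3, Lemma 4.1; Galdi 2000, Lemma 2.2 (weakly continuous representative).
-/

set_option linter.dupNamespace false

noncomputable section

open scoped BigOperators Topology ENNReal NNReal InnerProductSpace ComplexConjugate
open Filter Set Function MeasureTheory UnitAddTorus Complex

namespace Summit.AnomalousDissipation.AnomalousDissipation.Theorems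

open Literature.Analysis Literature.Analysis.FunctionSpaces Literature.Analysis.FunctionSpaces.Torus
open Literature.Analysis.FluidPDE Literature.Analysis.FluidPDE.Torus

variable {d : Type*} [Fintype d]

/-! ### Abstract weak convergence in `ℓ²(ℤ^d)` -/

/-- Young's inequality with a free parameter: `x y ≤ (η x² + y²/η)/2` for `η > 0`. [folklore] -/
theorem ssl_mul_le_young {x y η : ℝ} (hη : 0 < η) : x * y ≤ (η * x ^ 2 + y ^ 2 / η) / 2 := by
  obtain ⟨z, rfl⟩ : ∃ z, y = η * z := ⟨y / η, by field_simp⟩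
  have e : (η * z) ^ 2 / η = η * z ^ 2 := by
    field_simp
  rw [e]
  nlinarith [mul_nonneg hη.le (sq_nonneg (x - z))]

omit [Fintype d] in
/-- The pairing `k ↦ conj (a k) * w k` of two `ℓ²` families is absolutely summable. [folklore] -/
theorem ssl_summable_norm_conj_mul {a w : (d → ℤ) → ℂ} (ha : Summable fun k => ‖a k‖ ^ 2)
    (hw : Summable fun k => ‖w k‖ ^ 2) : Summable fun k => ‖conj (a k) * w k‖ := by
  refine Summable.of_nonneg_of_le (fun _ => norm_nonneg _) (fun k => ?_)
    (((ha.mul_left 1).add (hw.div_const 1)).div_const 2)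
  rw [norm_mul, Complex.norm_conj]
  have h := ssl_mul_le_young (x := ‖a k‖) (y := ‖w k‖) one_pos
  simpa using h

omit [Fintype d] in
/-- **Tail estimate** for the pairing: for `η > 0` and a finite frequency set `s`,
`‖∑_{k∉s} conj(aₖ) wₖ‖ ≤ (η ∑ₖ ‖aₖ‖² + η⁻¹ ∑_{k∉s} ‖wₖ‖²)/2`. [folklore] -/
theorem ssl_norm_tsum_compl_conj_mul_le {a w : (d → ℤ) → ℂ} (ha : Summable fun k => ‖a k‖ ^ 2)
    (hw : Summable fun k => ‖w k‖ ^ 2) {η : ℝ} (hη : 0 < η) (s : Finset (d → ℤ)) :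
    ‖∑' k : {k // k ∉ s}, conj (a k) * w k‖ ≤
      (η * ∑' k, ‖a k‖ ^ 2 + (∑' k : {k // k ∉ s}, ‖w (k : d → ℤ)‖ ^ 2) / η) / 2 := by
  have hs1 : Summable fun k : {k // k ∉ s} => ‖conj (a k) * w k‖ :=
    (ssl_summable_norm_conj_mul ha hw).subtype _
  have ha' : Summable fun k : {k // k ∉ s} => ‖a (k : d → ℤ)‖ ^ 2 := ha.subtype _
  have hw' : Summable fun k : {k // k ∉ s} => ‖w (k : d → ℤ)‖ ^ 2 := hw.subtype _
  calc ‖∑' k : {k // k ∉ s}, conj (a k) * w k‖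
      ≤ ∑' k : {k // k ∉ s}, ‖conj (a k) * w k‖ := norm_tsum_le_tsum_norm hs1
    _ ≤ ∑' k : {k // k ∉ s}, (η * ‖a (k : d → ℤ)‖ ^ 2 + ‖w (k : d → ℤ)‖ ^ 2 / η) / 2 := by
        refine hs1.tsum_le_tsum (fun k => ?_) (((ha'.mul_left η).add (hw'.div_const η)).div_const 2)
        rw [norm_mul, Complex.norm_conj]
        exact ssl_mul_le_young hη
    _ = (η * ∑' k : {k // k ∉ s}, ‖a (k : d → ℤ)‖ ^ 2 +
          (∑' k : {k // k ∉ s}, ‖w (k : d → ℤ)‖ ^ 2) / η) / 2 := by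
        rw [tsum_div_const, ((ha'.mul_left η)).tsum_add (hw'.div_const η), tsum_mul_left,
          tsum_div_const]
    _ ≤ (η * ∑' k, ‖a k‖ ^ 2 + (∑' k : {k // k ∉ s}, ‖w (k : d → ℤ)‖ ^ 2) / η) / 2 := by
        gcongr
        exact Summable.tsum_subtype_le (fun k => ‖a k‖ ^ 2) {k : d → ℤ | k ∉ s} (fun _ => sq_nonneg _) ha

omit [Fintype d] in
/-- **Abstract weak convergence in `ℓ²(ℤ^d)`.** If `a i → b` coefficientwise along a filter, with
`∑ₖ ‖a i k‖², ∑ₖ ‖b k‖² ≤ Y`, then `∑ₖ conj(a i k) w k → ∑ₖ conj(b k) w k` for every `w ∈ ℓ²`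
(finitely many modes converge; the tails are uniformly small by the tail estimate with Young's
free parameter). The Fourier-side form of "bounded sequences converging coefficientwise converge
weakly in `L²`" (Robinson–Rodrigo–Sadowski 2016, (4.12), Ex. 4.3). [cite: RobinsonRodrigoSadowski2016, Thm. 4.4 Step 3, (4.12), Ex. 4.3] -/
theorem ssl_tendsto_tsum_conj_mul {ι : Type*} {l : Filter ι} {a : ι → (d → ℤ) → ℂ}
    {b w : (d → ℤ) → ℂ} {Y : ℝ}
    (ha : ∀ᶠ i in l, Summable (fun k => ‖a i k‖ ^ 2) ∧ ∑' k, ‖a i k‖ ^ 2 ≤ Y)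
    (hb : Summable (fun k => ‖b k‖ ^ 2) ∧ ∑' k, ‖b k‖ ^ 2 ≤ Y)
    (hw : Summable fun k => ‖w k‖ ^ 2)
    (hlim : ∀ k, Tendsto (fun i => a i k) l (𝓝 (b k))) :
    Tendsto (fun i => ∑' k, conj (a i k) * w k) l (𝓝 (∑' k, conj (b k) * w k)) := by
  have hY : 0 ≤ Y := (tsum_nonneg fun _ => sq_nonneg _).trans hb.2
  rw [Metric.tendsto_nhds]
  intro ε hε
  -- the free parameter
  set η : ℝ := ε / (3 * (Y + 1)) with hη_def
  have hη : 0 < η := by positivity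
  have hηY : η * Y ≤ ε / 3 := by
    rw [hη_def, div_mul_eq_mul_div, div_le_div_iff₀ (by positivity) (by norm_num)]
    nlinarith
  -- the tail of `w`
  have htail := (tendsto_tsum_compl_atTop_zero fun k => ‖w k‖ ^ 2)
  rw [Metric.tendsto_nhds] at htail
  obtain ⟨s, hs⟩ := (htail (η * (ε / 3)) (by positivity)).exists
  rw [Real.dist_eq, sub_zero, abs_of_nonneg (tsum_nonneg fun _ => sq_nonneg _)] at hs
  have hsη : (∑' k : {k // k ∉ s}, ‖w (k : d → ℤ)‖ ^ 2) / η ≤ ε / 3 := by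
    rw [div_le_iff₀ hη]
    linarith
  -- tails of the pairings
  have htl : ∀ {a' : (d → ℤ) → ℂ}, Summable (fun k => ‖a' k‖ ^ 2) → ∑' k, ‖a' k‖ ^ 2 ≤ Y →
      ‖∑' k : {k // k ∉ s}, conj (a' k) * w k‖ ≤ ε / 3 := by
    intro a' ha1 ha2
    refine (ssl_norm_tsum_compl_conj_mul_le ha1 hw hη s).trans ?_
    have h1 : η * ∑' k, ‖a' k‖ ^ 2 ≤ ε / 3 :=
      (mul_le_mul_of_nonneg_left ha2 hη.le).trans hηY
    linarith
  -- the finitely many modes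
  have hfin : Tendsto (fun i => ∑ k ∈ s, conj (a i k) * w k) l (𝓝 (∑ k ∈ s, conj (b k) * w k)) :=
    tendsto_finsetSum _ fun k _ => ((Complex.continuous_conj.tendsto _).comp (hlim k)).mul_const _
  rw [Metric.tendsto_nhds] at hfin
  filter_upwards [hfin (ε / 3) (by positivity), ha] with i hi hai
  have hsa := (Summable.of_norm (ssl_summable_norm_conj_mul hai.1 hw)).sum_add_tsum_compl (s := s)
  have hsb := (Summable.of_norm (ssl_summable_norm_conj_mul hb.1 hw)).sum_add_tsum_compl (s := s)
  rw [dist_eq_norm] at hi ⊢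
  rw [← hsa, ← hsb]
  have hta := htl hai.1 hai.2
  have htb := htl hb.1 hb.2
  calc ‖(∑ k ∈ s, conj (a i k) * w k + ∑' k : {k // k ∉ s}, conj (a i k) * w k) -
        (∑ k ∈ s, conj (b k) * w k + ∑' k : {k // k ∉ s}, conj (b k) * w k)‖
      = ‖(∑ k ∈ s, conj (a i k) * w k - ∑ k ∈ s, conj (b k) * w k) +
          ∑' k : {k // k ∉ s}, conj (a i k) * w k - ∑' k : {k // k ∉ s}, conj (b k) * w k‖ := by
        congr 1; ring
    _ ≤ ‖∑ k ∈ s, conj (a i k) * w k - ∑ k ∈ s, conj (b k) * w k‖ +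
          ‖∑' k : {k // k ∉ s}, conj (a i k) * w k‖ + ‖∑' k : {k // k ∉ s}, conj (b k) * w k‖ :=
        norm_sub_le_of_le (norm_add_le _ _) le_rfl
    _ < ε := by linarith

/-! ### Riesz–Fischer for a conjugate-symmetric `ℓ²` family -/

/-- Fourier coefficients of the complex conjugate: `𝓕(conj ∘ G)(k) = conj (𝓕G(-k))`. [folklore] -/
theorem ssl_mFourierCoeff_conj (G : UnitAddTorus d → ℂ) (k : d → ℤ) :
    mFourierCoeff (fun x => conj (G x)) k = conj (mFourierCoeff G (-k)) := by
  simp only [mFourierCoeff, smul_eq_mul]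
  rw [← integral_conj]
  congr 1 with x
  simp [mFourier_neg]

/-- **Riesz–Fischer for a conjugate-symmetric square-summable family**: there is a real
`L²(T^d)` function whose (complexified) Fourier coefficients are the given `a` (the tree's
parametric Riesz–Fischer theorem at a Dirac parameter; the resulting complex function is a.e. real
because `conj ∘ G` has the same coefficients, Grafakos 2014, Prop. 3.2.7 (4), 3.2.6 (4)). [cite: Grafakos2014, Prop. 3.2.7 (4)] -/
theorem ssl_exists_memLp_real_of_coeff {a : (d → ℤ) → ℂ} (ha : Summable fun k => ‖a k‖ ^ 2)
    (hsymm : IsConjSymmScalar a) :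
    ∃ g : UnitAddTorus d → ℝ, MemLp g 2 volume ∧ ∀ k, mFourierCoeff (fun x => (g x : ℂ)) k = a k := by
  classical
  -- the parametric theorem at the Dirac parameter on `Unit`
  have hC : ∫⁻ _ : Unit, ∑' k, ‖a k‖ₑ ^ 2 ∂(Measure.dirac ()) ≠ ∞ := by
    rw [lintegral_dirac]
    have h1 : (fun k => ‖a k‖ₑ ^ 2) = fun k => ((‖a k‖₊ ^ 2 : ℝ≥0) : ℝ≥0∞) := by
      funext k
      rw [enorm_eq_nnnorm, ENNReal.coe_pow]
    rw [h1, ENNReal.tsum_coe_ne_top_iff_summable, ← NNReal.summable_coe]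
    simpa using ha
  obtain ⟨G, -, hG⟩ := exists_memLp_two_forall_mFourierCoeff_eq (μ := Measure.dirac ())
    (c := fun _ : Unit => a) (fun _ => aestronglyMeasurable_const) hC
  rw [ae_dirac_eq, eventually_pure] at hG
  obtain ⟨hG2, hGc⟩ := hG
  set F : UnitAddTorus d → ℂ := G () with hF
  have hFi : Integrable F volume := hG2.integrable one_le_two
  -- `conj ∘ F` has the same coefficients, hence `F` is a.e. real
  have hconj : (fun x => conj (F x)) =ᵐ[volume] F := by
    refine ae_eq_of_forall_mFourierCoeff_eq
      (Complex.conjLIE.toContinuousLinearEquiv.toContinuousLinearMap.integrable_comp hFi) hFi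
      fun k => ?_
    rw [ssl_mFourierCoeff_conj, hGc, hGc, hsymm k, Complex.conj_conj]
  refine ⟨fun x => (F x).re, ?_, fun k => ?_⟩
  · have h := hG2.re
    simpa only [RCLike.re_to_complex] using h
  · have hae : (fun x => (((F x).re : ℝ) : ℂ)) =ᵐ[volume] F := by
      filter_upwards [hconj] with x hx
      exact Complex.conj_eq_iff_re.1 hx
    rw [mFourierCoeff_congr_ae hae, hGc]

/-! ### The representative -/

variable {κ : ℝ} {u : ℝ → UnitAddTorus d → EuclideanSpace ℝ d} {hs θ₀ : UnitAddTorus d → ℝ}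
  {θ Θ : ℝ → UnitAddTorus d → ℝ} {B c : ℝ → (d → ℤ) → ℂ}

/-- **The everywhere-defined `L²` representative.** For a global weak sourced scalar `θ` with
`L²` datum `θ₀`, integrable steady source, and continuous modes `c` (part A), there is
`Θ : ℝ → T^d → ℝ` with `Θ 0 = θ₀`, with `Θ(t) ∈ L²` and `𝓕Θ(t) = c(t, ·)` for **every**
`t ≥ 0`, and with `Θ(t) = θ(t)` for a.e. `t ∈ (0,T)`, every `T > 0` (at the good times
`Θ(t) := θ(t)`; elsewhere Riesz–Fischer, `ssl_exists_memLp_real_of_coeff`). [folklore] -/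
theorem ssl_exists_repr [DecidableEq d]
    (hB : B = fun s k => -(((4 * Real.pi ^ 2 * κ * freqNormSq k : ℝ)) : ℂ) *
        mFourierCoeff (fun x => (θ s x : ℂ)) k -
      ∑ j, (2 * Real.pi * I * (k j)) * mFourierCoeff (fun x => ((θ s x * u s x j : ℝ) : ℂ)) k +
        mFourierCoeff (fun x => (hs x : ℂ)) k)
    (hc : c = fun t k => mFourierCoeff (fun x => (θ₀ x : ℂ)) k + ∫ s in Ioc 0 t, B s k)
    (hsol : ∀ T, 0 < T → IsWeakScalarTransportForcedOn T κ u (fun _ => hs) θ₀ θ)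
    (hhs : Integrable hs volume) (hθ₀ : MemLp θ₀ 2 volume) :
    ∃ Θ : ℝ → UnitAddTorus d → ℝ, Θ 0 = θ₀ ∧
      (∀ t, 0 ≤ t → MemLp (Θ t) 2 volume ∧ ∀ k, mFourierCoeff (fun x => (Θ t x : ℂ)) k = c t k) ∧
      ∀ T, 0 < T → ∀ᵐ t ∂(volume.restrict (Ioo 0 T)), Θ t = θ t := by
  classical
  have hθ₀i : Integrable θ₀ volume := hθ₀.integrable one_le_two
  -- square summability and reality of the modes at every `t ≥ 0`
  have hsq : ∀ t, 0 ≤ t → Summable (fun k => ‖c t k‖ ^ 2) := by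
    intro t ht
    obtain ⟨C, hC⟩ := (hsol (t + 1) (by linarith)).ae_lintegral_sq_le
    exact (ssl_summable_sq_mode hB hc hsol hhs hθ₀i (by linarith) hC ⟨ht, by linarith⟩).1
  -- the good times
  set Good : Set ℝ := {t | MemLp (θ t) 2 volume ∧ ∀ k, mFourierCoeff (fun x => (θ t x : ℂ)) k = c t k}
    with hGood
  -- the Riesz–Fischer slices
  have hRF : ∀ t, 0 ≤ t → ∃ g : UnitAddTorus d → ℝ, MemLp g 2 volume ∧
      ∀ k, mFourierCoeff (fun x => (g x : ℂ)) k = c t k :=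
    fun t ht => ssl_exists_memLp_real_of_coeff (hsq t ht) (ssl_isConjSymmScalar_mode hB hc t)
  refine ⟨fun t => if t = 0 then θ₀ else if t ∈ Good then θ t else
    if ht : 0 ≤ t then Classical.choose (hRF t ht) else θ t, by simp, fun t ht => ?_, fun T hT => ?_⟩
  · -- every `t ≥ 0`
    rcases eq_or_lt_of_le ht with h0 | hpos
    · subst h0
      simp only [if_true]
      refine ⟨hθ₀, fun k => ?_⟩
      rw [hc]
      simp
    · have hne : t ≠ 0 := hpos.ne'
      simp only [hne, if_false]
      by_cases hg : t ∈ Good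
      · simp only [hg, if_true]
        exact hg
      · simp only [hg, if_false, ht, dif_pos]
        exact Classical.choose_spec (hRF t ht)
  · -- a.e. `t ∈ (0, T)`
    filter_upwards [ssl_ae_mode_eq hB hc (hsol T hT) hhs hθ₀i, ae_restrict_mem measurableSet_Ioo]
      with t ht htI
    have hne : t ≠ 0 := htI.1.ne'
    have hg : t ∈ Good := ht
    simp only [hne, if_false, hg, if_true]

/-- **Energy of the representative**: `∫ Θ(t)² = ∑ₖ ‖c(t,k)‖² ≤ C` for every `t ∈ [0,T]`, `C`
the `L^∞_t L²_x` bound of the class on `(0,T)` (Parseval at every time). [folklore] -/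
theorem ssl_integral_sq_repr_le [DecidableEq d]
    (hB : B = fun s k => -(((4 * Real.pi ^ 2 * κ * freqNormSq k : ℝ)) : ℂ) *
        mFourierCoeff (fun x => (θ s x : ℂ)) k -
      ∑ j, (2 * Real.pi * I * (k j)) * mFourierCoeff (fun x => ((θ s x * u s x j : ℝ) : ℂ)) k +
        mFourierCoeff (fun x => (hs x : ℂ)) k)
    (hc : c = fun t k => mFourierCoeff (fun x => (θ₀ x : ℂ)) k + ∫ s in Ioc 0 t, B s k)
    (hsol : ∀ T, 0 < T → IsWeakScalarTransportForcedOn T κ u (fun _ => hs) θ₀ θ)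
    (hhs : Integrable hs volume) (hθ₀ : Integrable θ₀ volume)
    (hΘ : ∀ t, 0 ≤ t → MemLp (Θ t) 2 volume ∧ ∀ k, mFourierCoeff (fun x => (Θ t x : ℂ)) k = c t k)
    {T : ℝ} (hT : 0 < T) {C : ℝ≥0}
    (hC : ∀ᵐ t ∂(volume.restrict (Ioo 0 T)), ∫⁻ x, ‖θ t x‖ₑ ^ 2 ≤ C) {t : ℝ} (ht : t ∈ Icc 0 T) :
    ∫ x, Θ t x ^ 2 = ∑' k, ‖c t k‖ ^ 2 ∧ ∫ x, Θ t x ^ 2 ≤ (C : ℝ) := by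
  obtain ⟨hmem, hcoef⟩ := hΘ t ht.1
  have h1 := hasSum_sq_norm_mFourierCoeff_ofReal hmem
  simp only [hcoef] at h1
  rw [← h1.tsum_eq]
  exact ⟨rfl, (ssl_summable_sq_mode hB hc hsol hhs hθ₀ hT hC ht).2⟩

/-- The real pairing of two real `L²` functions as the Parseval series of their complexified
coefficients: `(∫ f g : ℂ) = ∑ₖ conj(𝓕f(k)) 𝓕g(k)`. [cite: Grafakos2014, Prop. 3.2.7 (3)] -/
theorem ssl_integral_mul_eq_tsum {f g : UnitAddTorus d → ℝ} (hf : MemLp f 2 volume)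
    (hg : MemLp g 2 volume) :
    ((∫ x, f x * g x : ℝ) : ℂ) =
      ∑' k, conj (mFourierCoeff (fun x => (f x : ℂ)) k) * mFourierCoeff (fun x => (g x : ℂ)) k := by
  have h := hasSum_conj_mul_mFourierCoeff (g := fun x => (f x : ℂ)) (h := fun x => (g x : ℂ)) hf.ofReal hg.ofReal
  rw [h.tsum_eq, ← integral_complex_ofReal]
  refine integral_congr_ae (ae_of_all _ fun x => ?_)
  simp only [Complex.ofReal_mul, Complex.conj_ofReal]

/-- **Weak continuity of the representative**: `t ↦ ∫ Θ(t) w` is continuous on `[0, ∞)` for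
every real `w ∈ L²(T^d)` (Parseval pairing and the abstract weak convergence
`ssl_tendsto_tsum_conj_mul`, the modes being continuous in `t` with a locally uniform `ℓ²`
bound; Galdi 2000, Lemma 2.2). [cite: RobinsonRodrigoSadowski2016, Thm. 4.4 Step 3, (4.12), Ex. 4.3] -/
theorem ssl_continuousOn_integral_repr_mul [DecidableEq d]
    (hB : B = fun s k => -(((4 * Real.pi ^ 2 * κ * freqNormSq k : ℝ)) : ℂ) *
        mFourierCoeff (fun x => (θ s x : ℂ)) k -
      ∑ j, (2 * Real.pi * I * (k j)) * mFourierCoeff (fun x => ((θ s x * u s x j : ℝ) : ℂ)) k +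
        mFourierCoeff (fun x => (hs x : ℂ)) k)
    (hc : c = fun t k => mFourierCoeff (fun x => (θ₀ x : ℂ)) k + ∫ s in Ioc 0 t, B s k)
    (hsol : ∀ T, 0 < T → IsWeakScalarTransportForcedOn T κ u (fun _ => hs) θ₀ θ)
    (hhs : Integrable hs volume) (hθ₀ : Integrable θ₀ volume)
    (hΘ : ∀ t, 0 ≤ t → MemLp (Θ t) 2 volume ∧ ∀ k, mFourierCoeff (fun x => (Θ t x : ℂ)) k = c t k)
    {w : UnitAddTorus d → ℝ} (hw : MemLp w 2 volume) :
    ContinuousOn (fun t => ∫ x, Θ t x * w x) (Ici 0) := by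
  intro t₀ ht₀
  have ht₀' : 0 ≤ t₀ := ht₀
  -- the uniform `ℓ²` bound on `[0, t₀ + 1]`
  have hT : 0 < t₀ + 1 := by linarith
  obtain ⟨C, hC⟩ := (hsol (t₀ + 1) hT).ae_lintegral_sq_le
  have hbd : ∀ t ∈ Icc 0 (t₀ + 1), Summable (fun k => ‖c t k‖ ^ 2) ∧ ∑' k, ‖c t k‖ ^ 2 ≤ (C : ℝ) :=
    fun t ht => ssl_summable_sq_mode hB hc hsol hhs hθ₀ hT hC ht
  -- Parseval pairing at every `t ≥ 0`
  set W : (d → ℤ) → ℂ := fun k => mFourierCoeff (fun x => (w x : ℂ)) k with hW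
  have hWs : Summable fun k => ‖W k‖ ^ 2 := (hasSum_sq_norm_mFourierCoeff_ofReal hw).summable
  have hpair : ∀ t, 0 ≤ t → ((∫ x, Θ t x * w x : ℝ) : ℂ) = ∑' k, conj (c t k) * W k := by
    intro t ht
    rw [ssl_integral_mul_eq_tsum (hΘ t ht).1 hw]
    simp only [(hΘ t ht).2, hW]
  -- the abstract weak convergence along `𝓝[Ici 0] t₀`
  have hmem : Icc 0 (t₀ + 1) ∈ 𝓝[Ici 0] t₀ := by
    have h1 : Ici (0 : ℝ) ∩ Iio (t₀ + 1) ⊆ Icc 0 (t₀ + 1) := fun t ht => ⟨ht.1, ht.2.le⟩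
    exact Filter.mem_of_superset (inter_mem_nhdsWithin (Ici 0) (Iio_mem_nhds (by linarith))) h1
  have key'' : Tendsto (fun t => ∑' k, conj (c t k) * W k) (𝓝[Ici 0] t₀)
      (𝓝 (∑' k, conj (c t₀ k) * W k)) := by
    refine ssl_tendsto_tsum_conj_mul (Y := (C : ℝ)) ?_ (hbd t₀ ⟨ht₀', by linarith⟩) hWs fun k =>
      ssl_continuousOn_mode hB hc hsol k t₀ ht₀
    filter_upwards [hmem] with t ht
    exact hbd t ht
  -- real parts
  have hre : Tendsto (fun t => (∑' k, conj (c t k) * W k).re) (𝓝[Ici 0] t₀)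
      (𝓝 ((∑' k, conj (c t₀ k) * W k).re)) := (Complex.continuous_re.tendsto _).comp key''
  refine (hre.congr' ?_).trans ?_
  · filter_upwards [self_mem_nhdsWithin] with t ht
    rw [← hpair t ht, Complex.ofReal_re]
  · rw [← hpair t₀ ht₀', Complex.ofReal_re]

end Summit.AnomalousDissipation.AnomalousDissipation.Theorems

end
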